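import Literature.MathematicalPhysics.QuantumFieldTheory.Balaban1983to89.Beta.ResolventCompositionStepB
import Literature.MathematicalPhysics.QuantumFieldTheory.Balaban1983to89.Beta.BalabanStepJetsSucc

/-!
# `BalabanUV.Beta.FP.TwoLevelGaugeDefect` — road «FP» for binder row D1, sub-row **MS-1-GAUGE (finite level)** (owner d1-p3 gen 12, `LEAVES-FP.md` l.549;
# design `HOME/b2b-balaban-beta-d1-p3/JETS-JM-DESIGN.md` v2 §4 (c)): LATTICE HODGE DUALITY «a bounded 1-form orthogonal to every finitely supported
# co-closed 1-form is EXACT», and its consequence for an5's transverse two-level telescoping `K1aTrans`: THE ENTRYWISE TWO-LEVEL DEFECT OF THE TYPED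
# RESOLVENTS, CONTRACTED WITH A CO-CLOSED TEST FORM ON ONE LEG, IS AN EXACT 1-FORM (`dz g`) IN THE OTHER LEG — every `d`, `Lc ≥ 1`, `j`; UNCONDITIONAL

HONEST DEPENDENCY (page 1, mandatory): continuum YM on T⁴ ⇐ BetaPertH ∧ nine spine estimates (0/9 proved); BetaPertH ⇐ (D1) ∧ (D4) ∧ CAP+tail;
G-an2-4 gates asym, D1 and NE2/3/4.  HONEST FRAMING (cell contract, verbatim): «discharging `BetaPertH` makes Bałaban's UV stability UNCONDITIONAL —
a real constructive-QFT result; it is NOT the continuum limit and NOT the Clay problem.»  THIS MODULE is [folklore] lattice exterior calculus on `ℤ^D`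
(an5's `AffineAveraging` ∕ `KKTFluctuationEnergy` ∕ `ResolventComposition` vocabulary BY NAME: `curv`, `curvAdj`, `codiff₁`, `dz`, `lip1`, `lip2`, `lip1_curvAdj`,
`codiff₁_curvAdj`, the lattice Poincaré lemma `exists_dz_eq_of_curv_eq_zero`) + an5's theorem `ResolventCompositionStepB.k1aTrans` + decay bookkeeping
(`decays_KInv`, `decays_KInvStep`, `decays_liftW`, `decays_comp`).  No `def`, no `def … : Prop`, nothing cited, 0 sorry; 0 estimates of Bałaban's
constrained objects; 0∕4 row-D1 binders; NOT the perfect-level statement, NOT an explicit potential, NOT MS-1-BOT (ii), NOT (STEP)∕SDF, NOT D1, NOT BetaPertH,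
NOT continuum, NOT Clay.  «not in print; our bookkeeping».
ABSOLUTE RULE (cell charter, verbatim): «No internally-minted statement may enter as a cited fact. Every hypothesis is either kernel-proved in this package or a
verbatim quotation of a PUBLISHED theorem with page reference. The manuscript(s) under audit are NOT citable for their own disputed steps — they are the thing
under adjudication; programme-internal (2001/route/tribunal) claims are never citable.»

WHY (JETS-JM-DESIGN v2 §4 (c); owner's located reading of the typed KKT rows `KKTFluctuationUnique.SolvesKKT`: (EL) `d*dA = 𝒬ᵀφ + d(δdμ) + F`, (G) `δdδA ∈ BC_N`,
(M), (Q)).  an5 decided that the ENTRYWISE two-level law for the typed resolvents is false for `j ≥ 1` (`ResolventComposition.K1aNeg` docstring: gauge-slice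
defect) and proved the TRANSVERSE law `K1aTrans` (the defect vanishes against finitely supported co-closed forms on both legs).  The END's step defect
`D m` of road FP's (STEP) door is that gauge-slice term contracted with vertex legs; N2b (`secondMoment (D m) μ ν = 0`) needs to know WHAT survives
entrywise.  This file answers at finite level: contracted with co-closed data on one leg, the defect is PURE GAUGE (`dz g`) in the free leg — so inside the
one-loop traces it meets the vertices' Ward (divergence) letters.

CONTENT.
* §1 (generic `D`) `lip2_elementary`, `summable_elementary`, `curvAdj_elementary_eq_zero`, `support_curvAdj_elementary_finite`,
  **`curv_eq_zero_of_lip1_coclosed`** (a bounded 1-form orthogonal to every finitely supported co-closed 1-form is curl-free: test against `curvAdj` of the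
  elementary 2-forms — co-closed by `codiff₁ ∘ curvAdj = 0` — and read off `curv` by `lip1_curvAdj`), **`exists_dz_eq_of_lip1_coclosed`** (hence EXACT, by
  an5's staircase Poincaré lemma).
* §2 (every `d`, `Lc ≥ 1`, `j`) `abs_le_of_decays`, `exists_twoLevelDefect_bound` (the field–field two-level defect kernel
  `E_j := KInv_{Lc^(j+1)} − KInv_{Lc^j} + KInv_{Lc^j} ∘ liftW (Lc^j) true true (KInvStep Lc j) ∘ KInv_{Lc^j}` is bounded),
  **`twoLevelDefect_right_contracted_exact`** (`∀` finitely supported co-closed `F′`: `x ↦ Σ'_y Σ_l E_j(x,y;κ,l)·F′ l y = dz g`),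
  **`twoLevelDefect_left_contracted_exact`** (the other leg).
NEXT (rows, not here): the same at the perfect objects (`j → ∞` in the adopted units), the explicit potentials (`dλ` + `ℋ_M·(coarse-exact)`), and the extension
to exponentially decaying co-closed data (MS-1-BOT (ii)'s test-form class).
Provenance: road «FP» OWNER, unit b2b-balaban-beta-d1-p3 gen 12 (prover-b2b-balaban-beta-d1-p3-g12-0), 2026-08-21; no existing file touched.
-/

noncomputable section

namespace Summit.QuantumFields.BalabanUV.Beta.FP.TwoLevelGaugeDefect

open Finset
open scoped BigOperators
open Literature.MathematicalPhysics.QuantumFieldTheory.Balaban1983to89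
open Literature.MathematicalPhysics.QuantumFieldTheory.Balaban1983to89.Beta
open B12Sec2to5 (l1 l1_nonneg)
open AffineAveraging (Form0 Form1 Form2 unitVec dz curv curvAdj codiff₁)
open ExpKernelCalculus (MKer Decays comp Zl Zl_nonneg)
open OneStepResolventKernel (Fib KInv decays_KInv decays_mono)
open OneStepKernelFamily (KInvStep decays_KInvStep)
open InterLevelTransport (liftW slotW slotW_nonneg decays_liftW)
open KKTFluctuationEnergy (lip1 lip2 lip1_curvAdj)
open ResolventComposition (codiff₁_curvAdj exists_dz_eq_of_curv_eq_zero)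
open ResolventCompositionStepB (k1aTrans tsum_pair_eq_sum exists_support_finset)
open BalabanStepJetsSucc (decays_comp)

/-! ## §1 Lattice Hodge duality: orthogonal to all finitely supported co-closed 1-forms ⟹ curl-free ⟹ exact -/

section Hodge

variable {D : ℕ}

/-- [folklore] The elementary 2-form at `(κ, l, x)` pairs with a 2-form to its `(κ, l, x)` entry. -/
theorem lip2_elementary (G : Form2 D ℝ) (κ l : Fin D) (x : Fin D → ℤ) :
    lip2 G (fun a b y => if a = κ ∧ b = l ∧ y = x then (1 : ℝ) else 0) = G κ l x := by
  unfold lip2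
  rw [tsum_eq_single x]
  · rw [Finset.sum_eq_single κ, Finset.sum_eq_single l]
    · simp
    · intro b _ hb; simp [hb]
    · intro h; exact absurd (Finset.mem_univ l) h
    · intro a _ ha; exact Finset.sum_eq_zero fun b _ => by simp [ha]
    · intro h; exact absurd (Finset.mem_univ κ) h
  · intro y hy
    exact Finset.sum_eq_zero fun a _ => Finset.sum_eq_zero fun b _ => by simp [hy]

/-- [folklore] The elementary 2-form is summable entrywise (finite support). -/
theorem summable_elementary (κ l : Fin D) (x : Fin D → ℤ) (a b : Fin D) :
    Summable (fun y : Fin D → ℤ => (fun a' b' y' => if a' = κ ∧ b' = l ∧ y' = x then (1 : ℝ) else 0) a b y) := by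
  refine summable_of_ne_finset_zero (s := {x}) fun y hy => ?_
  rw [Finset.mem_singleton] at hy
  simp [hy]

/-- [folklore] `curvAdj` of the elementary 2-form at `(κ, l, x)` is supported in `{x} ∪ {x + e_i}`. -/
theorem curvAdj_elementary_eq_zero {κ l : Fin D} {x : Fin D → ℤ} {μ : Fin D} {y : Fin D → ℤ} (hy : y ≠ x)
    (hy' : ∀ i : Fin D, y ≠ x + unitVec i) :
    curvAdj (fun a b y' => if a = κ ∧ b = l ∧ y' = x then (1 : ℝ) else 0) μ y = 0 := by
  have h1 : ∀ i : Fin D, y - unitVec i ≠ x := fun i h => hy' i (by rw [← h]; abel)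
  simp only [curvAdj, hy, h1, and_false, if_false, sub_zero]
  simp

/-- [folklore] `curvAdj` of the elementary 2-form is finitely supported. -/
theorem support_curvAdj_elementary_finite (κ l : Fin D) (x : Fin D → ℤ) (μ : Fin D) :
    (Function.support (curvAdj (fun a b y' => if a = κ ∧ b = l ∧ y' = x then (1 : ℝ) else 0) μ)).Finite := by
  refine (Set.finite_range (fun i : Fin D => x + unitVec i)).union (Set.finite_singleton x) |>.subset ?_
  intro y hy
  rw [Function.mem_support] at hy
  by_contra h
  simp only [Set.mem_union, Set.mem_range, Set.mem_singleton_iff, not_or, not_exists] at h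
  exact hy (curvAdj_elementary_eq_zero h.2 fun i hi => h.1 i hi.symm)

/-- [folklore] **A BOUNDED 1-FORM ORTHOGONAL TO EVERY FINITELY SUPPORTED CO-CLOSED 1-FORM IS CURL-FREE**: test against the co-closed forms
`curvAdj E_{κlx}` (`codiff₁ ∘ curvAdj = 0`, an5) and read off `(curv A)_{κl}(x)` by adjointness (`lip1_curvAdj`). -/
theorem curv_eq_zero_of_lip1_coclosed {A : Form1 D ℝ} {M : ℝ} (hA : ∀ μ x, |A μ x| ≤ M)
    (horth : ∀ F : Form1 D ℝ, (∀ κ, (Function.support (F κ)).Finite) → codiff₁ F = 0 → lip1 A F = 0) : curv A = 0 := by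
  funext κ l x
  have h := horth (curvAdj (fun a b y' => if a = κ ∧ b = l ∧ y' = x then (1 : ℝ) else 0))
    (support_curvAdj_elementary_finite κ l x) (codiff₁_curvAdj _)
  rw [lip1_curvAdj hA (summable_elementary κ l x), lip2_elementary] at h
  exact h

/-- [folklore] **LATTICE HODGE DUALITY**: a bounded 1-form on `ℤ^D` orthogonal to every finitely supported co-closed 1-form is EXACT — curl-free by
`curv_eq_zero_of_lip1_coclosed`, then an5's lattice Poincaré lemma `exists_dz_eq_of_curv_eq_zero` (explicit staircase potential). -/
theorem exists_dz_eq_of_lip1_coclosed {A : Form1 D ℝ} {M : ℝ} (hA : ∀ μ x, |A μ x| ≤ M)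
    (horth : ∀ F : Form1 D ℝ, (∀ κ, (Function.support (F κ)).Finite) → codiff₁ F = 0 → lip1 A F = 0) :
    ∃ g : Form0 D ℝ, dz g = A :=
  exists_dz_eq_of_curv_eq_zero (curv_eq_zero_of_lip1_coclosed hA horth)

end Hodge

/-! ## §2 The two-level defect of the typed resolvents is EXACT in each leg against co-closed data on the other leg -/

section Defect

variable {d : ℕ} (Lc : ℕ) [NeZero Lc]

/-- [folklore] A kernel decaying at a nonnegative rate is bounded by its constant. -/
theorem abs_le_of_decays {F : Type*} [Fintype F] {K : MKer (d + 1) F} {C δ : ℝ} (hK : Decays K C δ) (hδ : 0 ≤ δ) (a₀ : F)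
    (x y : Fin (d + 1) → ℤ) (a b : F) : |K x y a b| ≤ C :=
  (hK x y a b).trans (mul_le_of_le_one_right (hK.nonneg a₀) (Real.exp_le_one_iff.mpr (by nlinarith [l1_nonneg (x - y)])))

/-- [folklore] **THE TWO-LEVEL DEFECT KERNEL IS BOUNDED** (every `d`, `Lc ≥ 1`, `j`): the field–field entries of
`KInv_{Lc^(j+1)} − KInv_{Lc^j} + KInv_{Lc^j} ∘ liftW (Lc^j) true true (KInvStep Lc j) ∘ KInv_{Lc^j}` are bounded uniformly in the sites — every term decays
(`decays_KInv`, `decays_KInvStep`, `decays_liftW`, `decays_comp`). -/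
theorem exists_twoLevelDefect_bound (j : ℕ) : ∃ CE : ℝ, 0 ≤ CE ∧ ∀ (x y : Fin (d + 1) → ℤ) (κ l : Fin (d + 1)),
    |KInv (N := Lc ^ (j + 1)) (d := d) x y (Sum.inl κ) (Sum.inl l)
        - (KInv (N := Lc ^ j) (d := d) x y (Sum.inl κ) (Sum.inl l)
          - comp (KInv (N := Lc ^ j) (d := d))
              (comp (liftW (Lc ^ j) true true (KInvStep (d := d) Lc j)) (KInv (N := Lc ^ j) (d := d))) x y (Sum.inl κ) (Sum.inl l))|
      ≤ CE := by
  haveI : NeZero (Lc ^ j) := ⟨pow_ne_zero _ (NeZero.ne Lc)⟩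
  haveI : NeZero (Lc ^ (j + 1)) := ⟨pow_ne_zero _ (NeZero.ne Lc)⟩
  obtain ⟨δ₁, C₁, hδ₁, hC₁, hK₁⟩ := decays_KInv (N := Lc ^ (j + 1)) (d := d)
  obtain ⟨δ₀, C₀, hδ₀, hC₀, hK₀⟩ := decays_KInv (N := Lc ^ j) (d := d)
  obtain ⟨δ₂, C₂, hδ₂, hC₂, hS⟩ := decays_KInvStep (d := d) (Lc := Lc) j
  have hL := decays_liftW (Lc ^ j) true true hS
  have hPj : (0 : ℝ) < ((Lc ^ j : ℕ) : ℝ) := by exact_mod_cast Nat.pos_of_ne_zero (NeZero.ne (Lc ^ j))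
  set δs : ℝ := min δ₀ (δ₂ / ((Lc ^ j : ℕ) : ℝ)) with hδs
  have hδs0 : 0 < δs := lt_min hδ₀ (div_pos hδ₂ hPj)
  have hCL : 0 ≤ slotW d (Lc ^ j) true * slotW d (Lc ^ j) true * C₂ :=
    mul_nonneg (mul_nonneg (slotW_nonneg d _ true) (slotW_nonneg d _ true)) hC₂
  have hK₀' : Decays (KInv (N := Lc ^ j) (d := d)) C₀ δs := decays_mono hK₀ hC₀ le_rfl (min_le_left _ _)
  have hL' : Decays (liftW (Lc ^ j) true true (KInvStep (d := d) Lc j)) (slotW d (Lc ^ j) true * slotW d (Lc ^ j) true * C₂) δs :=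
    decays_mono hL hCL le_rfl (min_le_right _ _)
  have hin := decays_comp hL' hK₀' (δ' := δs / 2) (by positivity) (by linarith)
  have hK₀'' : Decays (KInv (N := Lc ^ j) (d := d)) C₀ (δs / 2) := decays_mono hK₀ hC₀ le_rfl (by
    have := min_le_left δ₀ (δ₂ / ((Lc ^ j : ℕ) : ℝ)); linarith)
  have hout := decays_comp hK₀'' hin (δ' := δs / 4) (by positivity) (by linarith)
  set CC : ℝ := (Fintype.card (Fib d) : ℝ) * (C₀ * ((Fintype.card (Fib d) : ℝ)
      * (slotW d (Lc ^ j) true * slotW d (Lc ^ j) true * C₂ * C₀) * Zl (d + 1) (δs - δs / 2))) * Zl (d + 1) (δs / 2 - δs / 4) with hCC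
  have hCC0 : 0 ≤ CC := hout.nonneg (Sum.inl 0)
  refine ⟨C₁ + (C₀ + CC), by positivity, fun x y κ l => ?_⟩
  refine (abs_sub _ _).trans (add_le_add (abs_le_of_decays hK₁ hδ₁.le (Sum.inl 0) x y _ _) ?_)
  refine (abs_sub _ _).trans (add_le_add (abs_le_of_decays hK₀ hδ₀.le (Sum.inl 0) x y _ _) ?_)
  exact abs_le_of_decays hout (by positivity) (Sum.inl 0) x y _ _

/-- [our proof] **THE TWO-LEVEL DEFECT, CONTRACTED WITH A CO-CLOSED TEST FORM ON THE RIGHT LEG, IS EXACT IN THE LEFT LEG** (every `d`, `Lc ≥ 1`, `j`).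
For every finitely supported CO-CLOSED `F′`, the 1-form
`x ↦ Σ'_y Σ_l [KInv_{Lc^(j+1)} − KInv_{Lc^j} + KInv_{Lc^j} ∘ liftW (Lc^j) true true (KInvStep Lc j) ∘ KInv_{Lc^j}](x, y; inl κ, inl l) · F′ l y`
is `dz g` for some `g` — an5's transverse telescoping `ResolventCompositionStepB.k1aTrans` (the defect vanishes against co-closed forms on BOTH legs) + the
lattice Hodge duality of §1.  This is the located shape of the gauge-slice defect (an5's `K1aNeg` docstring: the entrywise two-level law is FALSE): what
survives entrywise is PURE GAUGE in the free leg. -/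
theorem twoLevelDefect_right_contracted_exact (j : ℕ) (F' : Form1 (d + 1) ℝ) (hF' : ∀ κ, (Function.support (F' κ)).Finite)
    (hco' : codiff₁ F' = 0) :
    ∃ g : Form0 (d + 1) ℝ, dz g = fun κ x => ∑' y : Fin (d + 1) → ℤ, ∑ l : Fin (d + 1),
      (KInv (N := Lc ^ (j + 1)) (d := d) x y (Sum.inl κ) (Sum.inl l)
        - (KInv (N := Lc ^ j) (d := d) x y (Sum.inl κ) (Sum.inl l)
          - comp (KInv (N := Lc ^ j) (d := d))
              (comp (liftW (Lc ^ j) true true (KInvStep (d := d) Lc j)) (KInv (N := Lc ^ j) (d := d))) x y (Sum.inl κ) (Sum.inl l)))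
        * F' l y := by
  -- abbreviate the defect kernel
  set E : (Fin (d + 1) → ℤ) → (Fin (d + 1) → ℤ) → Fin (d + 1) → Fin (d + 1) → ℝ := fun x y κ l =>
    KInv (N := Lc ^ (j + 1)) (d := d) x y (Sum.inl κ) (Sum.inl l)
      - (KInv (N := Lc ^ j) (d := d) x y (Sum.inl κ) (Sum.inl l)
        - comp (KInv (N := Lc ^ j) (d := d))
            (comp (liftW (Lc ^ j) true true (KInvStep (d := d) Lc j)) (KInv (N := Lc ^ j) (d := d))) x y (Sum.inl κ) (Sum.inl l)) with hE
  obtain ⟨s', hs'⟩ := exists_support_finset F' hF'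
  obtain ⟨CE, hCE, hEb⟩ := exists_twoLevelDefect_bound (d := d) Lc j
  -- the contracted form is a finite sum, hence bounded
  have hc : ∀ κ x, (∑' y, ∑ l, E x y κ l * F' l y) = ∑ y ∈ s', ∑ l, E x y κ l * F' l y := fun κ x =>
    tsum_eq_sum fun y hy => Finset.sum_eq_zero fun l _ => by rw [hs' l y hy, mul_zero]
  have hbd : ∀ κ x, |∑' y, ∑ l, E x y κ l * F' l y| ≤ ∑ y ∈ s', ∑ l : Fin (d + 1), CE * |F' l y| := by
    intro κ x
    rw [hc]
    refine (Finset.abs_sum_le_sum_abs _ _).trans (Finset.sum_le_sum fun y _ => (Finset.abs_sum_le_sum_abs _ _).trans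
      (Finset.sum_le_sum fun l _ => ?_))
    rw [abs_mul]
    exact mul_le_mul_of_nonneg_right (hEb x y κ l) (abs_nonneg _)
  refine exists_dz_eq_of_lip1_coclosed hbd fun F hF hco => ?_
  -- orthogonality to every finitely supported co-closed `F`: an5's `k1aTrans`
  obtain ⟨s, hs⟩ := exists_support_finset F hF
  have hK := (k1aTrans (d := d) Lc j) F F' hF hF' hco hco'
  rw [tsum_pair_eq_sum F F' s s' hs hs' (fun x y κ l => KInv (N := Lc ^ (j + 1)) (d := d) x y (Sum.inl κ) (Sum.inl l)),
    tsum_pair_eq_sum F F' s s' hs hs' (fun x y κ l => KInv (N := Lc ^ j) (d := d) x y (Sum.inl κ) (Sum.inl l)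
      - comp (KInv (N := Lc ^ j) (d := d))
          (comp (liftW (Lc ^ j) true true (KInvStep (d := d) Lc j)) (KInv (N := Lc ^ j) (d := d))) x y (Sum.inl κ) (Sum.inl l))] at hK
  unfold KKTFluctuationEnergy.lip1
  rw [tsum_eq_sum (s := s) (fun x hx => Finset.sum_eq_zero fun μ _ => by rw [hs μ x hx, mul_zero])]
  have key : ∀ x, ∑ μ, (∑' y, ∑ l, E x y μ l * F' l y) * F μ x
      = (∑ y ∈ s', ∑ μ, ∑ l, F μ x * KInv (N := Lc ^ (j + 1)) (d := d) x y (Sum.inl μ) (Sum.inl l) * F' l y)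
        - ∑ y ∈ s', ∑ μ, ∑ l, F μ x * (KInv (N := Lc ^ j) (d := d) x y (Sum.inl μ) (Sum.inl l)
          - comp (KInv (N := Lc ^ j) (d := d))
              (comp (liftW (Lc ^ j) true true (KInvStep (d := d) Lc j)) (KInv (N := Lc ^ j) (d := d))) x y (Sum.inl μ) (Sum.inl l))
          * F' l y := by
    intro x
    simp only [hc, Finset.sum_mul]
    rw [Finset.sum_comm, ← Finset.sum_sub_distrib]
    refine Finset.sum_congr rfl fun y _ => ?_
    rw [← Finset.sum_sub_distrib]
    refine Finset.sum_congr rfl fun μ _ => ?_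
    rw [← Finset.sum_sub_distrib]
    refine Finset.sum_congr rfl fun l _ => ?_
    simp only [hE]
    ring
  have hgoal : ∑ x ∈ s, ∑ μ, (∑' y, ∑ l, E x y μ l * F' l y) * F μ x = 0 := by
    rw [Finset.sum_congr rfl fun x _ => key x, Finset.sum_sub_distrib]
    exact sub_eq_zero.mpr hK
  exact hgoal

/-- [our proof] **THE SAME ON THE OTHER LEG**: contracted with a finitely supported CO-CLOSED `F` on the LEFT leg, the defect is exact in the RIGHT leg
(`k1aTrans` is symmetric in the roles of the two test forms). -/
theorem twoLevelDefect_left_contracted_exact (j : ℕ) (F : Form1 (d + 1) ℝ) (hF : ∀ κ, (Function.support (F κ)).Finite)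
    (hco : codiff₁ F = 0) :
    ∃ g : Form0 (d + 1) ℝ, dz g = fun l y => ∑' x : Fin (d + 1) → ℤ, ∑ κ : Fin (d + 1),
      F κ x * (KInv (N := Lc ^ (j + 1)) (d := d) x y (Sum.inl κ) (Sum.inl l)
        - (KInv (N := Lc ^ j) (d := d) x y (Sum.inl κ) (Sum.inl l)
          - comp (KInv (N := Lc ^ j) (d := d))
              (comp (liftW (Lc ^ j) true true (KInvStep (d := d) Lc j)) (KInv (N := Lc ^ j) (d := d))) x y (Sum.inl κ) (Sum.inl l))) := by
  set E : (Fin (d + 1) → ℤ) → (Fin (d + 1) → ℤ) → Fin (d + 1) → Fin (d + 1) → ℝ := fun x y κ l =>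
    KInv (N := Lc ^ (j + 1)) (d := d) x y (Sum.inl κ) (Sum.inl l)
      - (KInv (N := Lc ^ j) (d := d) x y (Sum.inl κ) (Sum.inl l)
        - comp (KInv (N := Lc ^ j) (d := d))
            (comp (liftW (Lc ^ j) true true (KInvStep (d := d) Lc j)) (KInv (N := Lc ^ j) (d := d))) x y (Sum.inl κ) (Sum.inl l)) with hE
  obtain ⟨s, hs⟩ := exists_support_finset F hF
  obtain ⟨CE, hCE, hEb⟩ := exists_twoLevelDefect_bound (d := d) Lc j
  have hc : ∀ l y, (∑' x, ∑ κ, F κ x * E x y κ l) = ∑ x ∈ s, ∑ κ, F κ x * E x y κ l := fun l y =>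
    tsum_eq_sum fun x hx => Finset.sum_eq_zero fun κ _ => by rw [hs κ x hx, zero_mul]
  have hbd : ∀ l y, |∑' x, ∑ κ, F κ x * E x y κ l| ≤ ∑ x ∈ s, ∑ κ : Fin (d + 1), |F κ x| * CE := by
    intro l y
    rw [hc]
    refine (Finset.abs_sum_le_sum_abs _ _).trans (Finset.sum_le_sum fun x _ => (Finset.abs_sum_le_sum_abs _ _).trans
      (Finset.sum_le_sum fun κ _ => ?_))
    rw [abs_mul]
    exact mul_le_mul_of_nonneg_left (hEb x y κ l) (abs_nonneg _)
  refine exists_dz_eq_of_lip1_coclosed hbd fun F' hF' hco' => ?_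
  obtain ⟨s', hs'⟩ := exists_support_finset F' hF'
  have hK := (k1aTrans (d := d) Lc j) F F' hF hF' hco hco'
  rw [tsum_pair_eq_sum F F' s s' hs hs' (fun x y κ l => KInv (N := Lc ^ (j + 1)) (d := d) x y (Sum.inl κ) (Sum.inl l)),
    tsum_pair_eq_sum F F' s s' hs hs' (fun x y κ l => KInv (N := Lc ^ j) (d := d) x y (Sum.inl κ) (Sum.inl l)
      - comp (KInv (N := Lc ^ j) (d := d))
          (comp (liftW (Lc ^ j) true true (KInvStep (d := d) Lc j)) (KInv (N := Lc ^ j) (d := d))) x y (Sum.inl κ) (Sum.inl l))] at hK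
  unfold KKTFluctuationEnergy.lip1
  rw [tsum_eq_sum (s := s') (fun y hy => Finset.sum_eq_zero fun l _ => by rw [hs' l y hy, mul_zero])]
  have key : ∀ y, ∑ l, (∑' x, ∑ κ, F κ x * E x y κ l) * F' l y
      = (∑ x ∈ s, ∑ κ, ∑ l, F κ x * KInv (N := Lc ^ (j + 1)) (d := d) x y (Sum.inl κ) (Sum.inl l) * F' l y)
        - ∑ x ∈ s, ∑ κ, ∑ l, F κ x * (KInv (N := Lc ^ j) (d := d) x y (Sum.inl κ) (Sum.inl l)
          - comp (KInv (N := Lc ^ j) (d := d))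
              (comp (liftW (Lc ^ j) true true (KInvStep (d := d) Lc j)) (KInv (N := Lc ^ j) (d := d))) x y (Sum.inl κ) (Sum.inl l))
          * F' l y := by
    intro y
    simp only [hc, Finset.sum_mul]
    rw [Finset.sum_comm, ← Finset.sum_sub_distrib]
    refine Finset.sum_congr rfl fun x _ => ?_
    rw [Finset.sum_comm, ← Finset.sum_sub_distrib]
    refine Finset.sum_congr rfl fun κ _ => ?_
    rw [← Finset.sum_sub_distrib]
    refine Finset.sum_congr rfl fun l _ => ?_
    simp only [hE]
    ring
  rw [Finset.sum_comm] at hK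
  have hK' : (∑ y ∈ s', ∑ x ∈ s, ∑ κ, ∑ l, F κ x * KInv (N := Lc ^ (j + 1)) (d := d) x y (Sum.inl κ) (Sum.inl l) * F' l y)
      = ∑ y ∈ s', ∑ x ∈ s, ∑ κ, ∑ l, F κ x * (KInv (N := Lc ^ j) (d := d) x y (Sum.inl κ) (Sum.inl l)
          - comp (KInv (N := Lc ^ j) (d := d))
              (comp (liftW (Lc ^ j) true true (KInvStep (d := d) Lc j)) (KInv (N := Lc ^ j) (d := d))) x y (Sum.inl κ) (Sum.inl l))
          * F' l y := by
    rw [hK, Finset.sum_comm]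
  have hgoal : ∑ y ∈ s', ∑ l, (∑' x, ∑ κ, F κ x * E x y κ l) * F' l y = 0 := by
    rw [Finset.sum_congr rfl fun y _ => key y, Finset.sum_sub_distrib]
    exact sub_eq_zero.mpr hK'
  exact hgoal

end Defect

end Summit.QuantumFields.BalabanUV.Beta.FP.TwoLevelGaugeDefect

end
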